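import Mathlib
import HarnessLib
import Literature.LinearAlgebra.Matrix.ChordalPositiveSemidefinite
import Literature.Combinatorics.SimpleGraph.ChordalGraph

/-!
# Positive semidefinite completion with a chordal sparsity pattern
(Grone–Johnson–Sá–Wolkowicz 1984, Thm 7; Vandenberghe–Andersen 2015, Thm 10.1 and p. 357)

Companion to `Literature.LinearAlgebra.Matrix.ChordalPositiveSemidefinite` (the clique
DECOMPOSITION `𝐒ⁿ₊ ∩ 𝐒ⁿ_E = Σ_β 𝒦_β`, [VA15, Thm 9.2]); this file records the dual statement, the
description of the cone `Π_E(𝐒ⁿ₊)` of matrices with pattern `E` that admit a positive semidefinite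
COMPLETION [VA15, §10.1]:

* `posSemidef_completable_iff` — for a symmetric pattern `E` that is monotone transitive for the
  order of the index type (a perfect elimination ordering, i.e. `E` chordal, [VA15, Thm 4.1]) a
  partial Hermitian matrix `X` (entries `X i j` prescribed for `i = j` and for `{i,j} ∈ E`) has a
  positive semidefinite completion `Y ⪰ 0`, `Y i j = X i j` on the prescribed entries, IF AND ONLY
  IF every clique block `X[col(v), col(v)]` is positive semidefinite
  ([VA15, Thm 10.1, (10.1)]; [GJSW84, Thm 7]: the patterns for which "all fully specified
  principal blocks PSD" suffices are exactly the chordal ones).  Only the cliques `col(v)`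
  (`ChordalSparsity.clique`, [VA15, §4.4]) are quantified; every clique of a filled graph is one
  of them.
* `exists_posSemidef_completion` / `exists_posSemidef_completion_iff` — the same with the clique
  condition phrased as "some PSD matrix agrees with `X` on `col(v) × col(v)`".
* ORDER-FREE FORM AND THE CONVERSE (section `Chordal`, over
  `Literature.Combinatorics.SimpleGraph.ChordalGraph`: chordal = no chordless cycle of length `≥ 4`,
  and [VA15, Thm 4.1] = existence of a perfect elimination ordering, proved there from Dirac's
  theorem): `IsChordal.exists_posSemidef_completion` — for a CHORDAL sparsity graph `G` every
  partial matrix whose clique blocks `X[W, W]` (`W` complete in `G`) are positive semidefinite has a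
  positive semidefinite completion; `exists_not_posSemidef_completable_of_isChordlessCycle` /
  `…_of_not_isChordal` — **the necessity of chordality** [VA15, p. 357] = [GJSW84, proof of Thm 7
  "only if"]: along a chordless cycle `(v₀, …, v_{k-1}, v₀)`, `k ≥ 4`, the matrix `X ∈ 𝐒ⁿ_E` with
  unit diagonal, `X_{vᵢvᵢ₊₁} = 1`, `X_{v_{k-1}v₀} = -1` and zeros elsewhere has all clique blocks
  positive semidefinite and no positive semidefinite completion; hence
  **`isChordal_iff_forall_posSemidef_completable` — [GJSW84, Thm 7]: a finite graph is chordal iff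
  every partial matrix with positive semidefinite clique blocks has a positive semidefinite
  completion** (the "(nonnegative-)completable" graphs of [GJSW84, §4] are exactly the chordal
  ones).

The proof is the recursive completion along the elimination ordering ([VA15, §10.2, the
discussion of (10.9)–(10.11)]; [GJSW84, proof of Thm 7 via one-step extensions]): eliminate the
lowest vertex `a`, complete the remaining partial matrix on `S ∖ {a}` by induction to `P ⪰ 0`,
and BORDER `P` by row/column `a`.  The border column is `u = P c` where `c`, supported on the
higher neighbourhood `N = adj⁺(a)`, solves `X[N,N] c = X[N,a]` — solvable because in the PSD
clique block `X[col(a), col(a)]` the column `X[N,a]` lies in the range of `X[N,N]`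
(`exists_mulVec_eq_col_of_posSemidef`, the range condition [VA15, (10.9)]
`A_{αν} = A_{αα} A_{αα}⁺ A_{αν}`); positive semidefiniteness of the bordered matrix is the identity
`x⋆ Y x = (x + x_a c)⋆ P (x + x_a c) + |x_a|² (X_{aa} - c⋆ X[N,N] c)` (`posSemidef_border`) together
with `c⋆ X[N,N] c ≤ X_{aa}`, which is `(e_a - c)⋆ G (e_a - c) ≥ 0` in the clique block.

Scalars: an `RCLike` field `𝕜` (`ℝ` or `ℂ`), "positive semidefinite" is `Matrix.PosSemidef`
(Hermitian with nonnegative quadratic form, `open scoped ComplexOrder`).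

NOT in this file: the interior/positive-definite half of [VA15, Thm 10.1]
(`A ∈ Π_E(𝐒ⁿ₊₊) ⟺ A_ββ ≻ 0`) and maximum-determinant completions [VA15, §10.2 Alg. 10.1] (both in
`ChordalMaximumDeterminantCompletion`), the positive DEFINITE form of the converse ([GJSW84,
Prop. 2]: "completable = nonnegative-completable", a compactness argument), and the
Euclidean-distance-matrix analogue [VA15, §10.5].

References (keys of `lean/references.bib`): [VandenbergheAndersen2015] L. Vandenberghe,
M. S. Andersen, *Chordal graphs and semidefinite optimization*, Found. Trends Optim. 1 (2015)
241–433, doi:10.1561/2400000006 — §10.1 Thm 10.1 (pp. 356–357) with the counterexample for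
non-chordal patterns (p. 357), §10.2 (10.9)–(10.11) (p. 360) (page checks against the authors'
copy, `lit` key `paper:url-1b9fdea6a8a3`, PDF p. = book p. − 236); [GroneEtAl1984] R. Grone,
C. R. Johnson, E. M. Sá, H. Wolkowicz, *Positive definite completions of partial Hermitian
matrices*, Linear Algebra Appl. 58 (1984) 109–124, doi:10.1016/0024-3795(84)90207-6 — §4
("completable" graphs, Prop. 1–2, pp. 118–119), §5 Thm 7 (p. 120) and its "only if" proof with
the `±1` cycle matrix (pp. 121–122) (held text checked, `lit` key
`paper:doi-10-1016-0024-3795-84-90207-6`); [HornJohnson2013] R. A. Horn, C. R. Johnson, *Matrix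
Analysis*, 2nd ed., §7.1 Observation 7.1.10 and §7.7 (bordered matrices / generalized Schur
complements).
-/

noncomputable section

open scoped ComplexOrder MatrixOrder
open Matrix Finset

namespace Literature.LinearAlgebra.Matrix

namespace ChordalSparsity

variable {𝕜 : Type*} [RCLike 𝕜]
variable {ι : Type*}

/-! ### The range condition (10.9) inside a positive semidefinite matrix -/

section Range

variable [Fintype ι] [DecidableEq ι]

omit [DecidableEq ι] in
/-- `M c` at a row, as a sum over the support of `c`. [folklore] -/
private theorem mulVec_apply_eq_sum_of_support {N : Finset ι} {c : ι → 𝕜}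
    (hc : ∀ i, i ∉ N → c i = 0) (M : Matrix ι ι 𝕜) (j : ι) :
    (M *ᵥ c) j = ∑ k ∈ N, M j k * c k := by
  simp only [Matrix.mulVec, dotProduct]
  exact (Finset.sum_subset (Finset.subset_univ N) fun k _ hk => by rw [hc k hk, mul_zero]).symm

omit [DecidableEq ι] in
/-- `c⋆ w` as a sum over the support of `c`. [folklore] -/
private theorem star_dotProduct_eq_sum_of_support {N : Finset ι} {c : ι → 𝕜}
    (hc : ∀ i, i ∉ N → c i = 0) (w : ι → 𝕜) :
    star c ⬝ᵥ w = ∑ k ∈ N, star (c k) * w k := by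
  simp only [dotProduct, Pi.star_apply]
  exact (Finset.sum_subset (Finset.subset_univ N) fun k _ hk => by
    rw [hc k hk, star_zero, zero_mul]).symm

/-- THE RANGE CONDITION IN A POSITIVE SEMIDEFINITE MATRIX ([VA15, (10.9)]:
`A_{αν} = A_{αα} A_{αα}⁺ A_{αν}` for every principal block `α` of `A ⪰ 0`): for `G ⪰ 0`, any index
set `N` and any index `a`, the part of column `a` inside `N` lies in the range of the principal
block `G[N,N]` — there is `c` supported on `N` with `Σ_{k ∈ N} G j k c k = G j a` for all `j ∈ N`.
(Proof: `G = A⋆A`; with `A_N = A D_N`, `range (A_N⋆ A_N) = range A_N⋆` by the rank identity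
`rank (B⋆B) = rank B⋆`, and `D_N G e_a = A_N⋆ (A e_a)`.)
[cite: VandenbergheAndersen2015, §10.2 eq. (10.9)] -/
theorem exists_mulVec_eq_col_of_posSemidef {G : Matrix ι ι 𝕜} (hG : G.PosSemidef)
    (N : Finset ι) (a : ι) :
    ∃ c : ι → 𝕜, (∀ i, i ∉ N → c i = 0) ∧ ∀ j ∈ N, (G *ᵥ c) j = G j a := by
  obtain ⟨A, hA⟩ := CStarAlgebra.nonneg_iff_eq_star_mul_self.mp hG.nonneg
  have hGA : G = Aᴴ * A := by rw [hA, star_eq_conjTranspose]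
  set D : Matrix ι ι 𝕜 := diagonal fun i => if i ∈ N then (1 : 𝕜) else 0 with hD
  have hDct : Dᴴ = D := by
    rw [hD, diagonal_conjTranspose]
    congr 1
    funext i
    simp only [Pi.star_apply]
    split_ifs <;> simp
  have hDin : ∀ (v : ι → 𝕜), ∀ j ∈ N, (D *ᵥ v) j = v j := fun v j hj => by
    rw [hD, mulVec_diagonal, if_pos hj, one_mul]
  have hDout : ∀ (v : ι → 𝕜) (i : ι), i ∉ N → (D *ᵥ v) i = 0 := fun v i hi => by
    rw [hD, mulVec_diagonal, if_neg hi, zero_mul]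
  set AN : Matrix ι ι 𝕜 := A * D with hAN
  have hrange : LinearMap.range (ANᴴ * AN).mulVecLin = LinearMap.range ANᴴ.mulVecLin := by
    apply Submodule.eq_of_le_of_finrank_eq
    · rw [Matrix.mulVecLin_mul]
      exact LinearMap.range_comp_le_range _ _
    · change (ANᴴ * AN).rank = ANᴴ.rank
      rw [Matrix.rank_conjTranspose_mul_self, Matrix.rank_conjTranspose]
  have hmem : ANᴴ *ᵥ (A *ᵥ Pi.single a 1) ∈ LinearMap.range (ANᴴ * AN).mulVecLin := by
    rw [hrange]
    exact ⟨A *ᵥ Pi.single a 1, rfl⟩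
  obtain ⟨c', hc'⟩ := hmem
  refine ⟨D *ᵥ c', hDout c', fun j hj => ?_⟩
  have h1 : ((ANᴴ * AN) *ᵥ c') j = (ANᴴ *ᵥ (A *ᵥ Pi.single a 1)) j := by
    rw [← hc']
    rfl
  have hL : ANᴴ * AN = D * (G * D) := by
    simp only [hAN, conjTranspose_mul, hDct, hGA, Matrix.mul_assoc]
  have hR : ANᴴ *ᵥ (A *ᵥ Pi.single a 1) = D *ᵥ (G *ᵥ Pi.single a 1) := by
    simp only [hAN, conjTranspose_mul, hDct, hGA, Matrix.mulVec_mulVec, Matrix.mul_assoc]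
  rw [hL, hR, ← mulVec_mulVec, hDin _ j hj, ← mulVec_mulVec, hDin _ j hj,
    Matrix.mulVec_single_one] at h1
  rw [h1]
  rfl

end Range

/-! ### Bordering a positive semidefinite matrix -/

section Border

variable [DecidableEq ι]

/-- BORDERING.  `border P a d u = P + e_a (d e_aᵀ + u⋆) + u e_aᵀ`: when row and column `a` of `P`
vanish and `u a = 0` this is `P` with the entry `d` placed at `(a,a)`, the vector `u` down column
`a` and `u⋆` along row `a` — one step of the recursive completion (the bordered matrices
`[A_νν, A_ανᵀ; A_αν, A_αα]` of [VA15, §10.2]). [cite: VandenbergheAndersen2015, §10.2 eq. (10.6)] -/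
def border (P : Matrix ι ι 𝕜) (a : ι) (d : 𝕜) (u : ι → 𝕜) : Matrix ι ι 𝕜 :=
  P + (vecMulVec (Pi.single a 1) (d • Pi.single a 1 + star u) + vecMulVec u (Pi.single a 1))

/-- Entries of the bordered matrix. [cite: VandenbergheAndersen2015, §10.2 eq. (10.6)] -/
theorem border_apply (P : Matrix ι ι 𝕜) (a : ι) (d : 𝕜) (u : ι → 𝕜) (i j : ι) :
    border P a d u i j =
      P i j + ((Pi.single a 1 : ι → 𝕜) i * (d * (Pi.single a 1 : ι → 𝕜) j + star (u j)) +
        u i * (Pi.single a 1 : ι → 𝕜) j) := by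
  simp only [border, Matrix.add_apply, vecMulVec_apply, Pi.add_apply, Pi.smul_apply,
    Pi.star_apply, smul_eq_mul]

/-- The new diagonal entry is `d`. [cite: VandenbergheAndersen2015, §10.2 eq. (10.6)] -/
theorem border_apply_same {P : Matrix ι ι 𝕜} {a : ι} (d : 𝕜) {u : ι → 𝕜} (hP : P a a = 0)
    (hu : u a = 0) : border P a d u a a = d := by
  rw [border_apply, hP, hu, Pi.single_eq_same, star_zero, add_zero, mul_one, one_mul, zero_mul,
    add_zero, zero_add]

/-- The new column is `u`. [cite: VandenbergheAndersen2015, §10.2 eq. (10.6)] -/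
theorem border_apply_col {P : Matrix ι ι 𝕜} {a : ι} (d : 𝕜) (u : ι → 𝕜) {i : ι} (hi : i ≠ a)
    (hP : P i a = 0) : border P a d u i a = u i := by
  rw [border_apply, hP, Pi.single_eq_of_ne hi, zero_mul, zero_add, Pi.single_eq_same, mul_one,
    zero_add]

/-- The new row is `u⋆`. [cite: VandenbergheAndersen2015, §10.2 eq. (10.6)] -/
theorem border_apply_row {P : Matrix ι ι 𝕜} {a : ι} (d : 𝕜) (u : ι → 𝕜) {j : ι} (hj : j ≠ a)
    (hP : P a j = 0) : border P a d u a j = star (u j) := by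
  rw [border_apply, hP, Pi.single_eq_same, one_mul, Pi.single_eq_of_ne hj, mul_zero, zero_add,
    mul_zero, add_zero, zero_add]

/-- Away from row and column `a` the bordered matrix is `P`.
[cite: VandenbergheAndersen2015, §10.2 eq. (10.6)] -/
theorem border_apply_of_ne (P : Matrix ι ι 𝕜) {a : ι} (d : 𝕜) (u : ι → 𝕜) {i j : ι} (hi : i ≠ a)
    (hj : j ≠ a) : border P a d u i j = P i j := by
  rw [border_apply, Pi.single_eq_of_ne hi, Pi.single_eq_of_ne hj, zero_mul, mul_zero, add_zero,
    add_zero]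

variable [Fintype ι]

omit [DecidableEq ι] in
/-- The quadratic form of a rank-one matrix: `u ⋅ (v wᵀ) x = (u ⋅ v) (w ⋅ x)`. [folklore] -/
private theorem dotProduct_vecMulVec_mulVec (u v w x : ι → 𝕜) :
    u ⬝ᵥ (vecMulVec v w *ᵥ x) = (u ⬝ᵥ v) * (w ⬝ᵥ x) := by
  simp only [dotProduct, Matrix.mulVec, Matrix.vecMulVec_apply]
  rw [Finset.sum_mul_sum]
  refine Finset.sum_congr rfl fun i _ => ?_
  rw [Finset.mul_sum]
  exact Finset.sum_congr rfl fun j _ => by ring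

/-- The quadratic form of the bordered matrix. [folklore] -/
private theorem quadForm_border (P : Matrix ι ι 𝕜) (a : ι) (d : 𝕜) (u x : ι → 𝕜) :
    star x ⬝ᵥ (border P a d u *ᵥ x) =
      star x ⬝ᵥ (P *ᵥ x) + (star (x a) * (d * x a + star u ⬝ᵥ x) + (star x ⬝ᵥ u) * x a) := by
  rw [border, Matrix.add_mulVec, Matrix.add_mulVec, dotProduct_add, dotProduct_add,
    dotProduct_vecMulVec_mulVec, dotProduct_vecMulVec_mulVec, add_dotProduct, smul_dotProduct,
    single_one_dotProduct, dotProduct_single_one, smul_eq_mul, Pi.star_apply]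

/-- BORDERING A POSITIVE SEMIDEFINITE MATRIX (the semidefinite case (10.10)–(10.11) of the
completion recursion; a generalized-Schur-complement criterion, cf. [HJ13, §7.7]): for `P ⪰ 0`,
any vector `c` and a self-adjoint `d` with `c⋆ P c ≤ d`, the matrix `border P a d (P c)` is
positive semidefinite, by the identity
`x⋆ Y x = (x + x_a c)⋆ P (x + x_a c) + x_a⋆ x_a (d - c⋆ P c)`.
[cite: VandenbergheAndersen2015, §10.2 eq. (10.10)–(10.11)] -/
theorem posSemidef_border {P : Matrix ι ι 𝕜} (hP : P.PosSemidef) (a : ι) {d : 𝕜}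
    (hd : IsSelfAdjoint d) (c : ι → 𝕜) (hdc : 0 ≤ d - star c ⬝ᵥ (P *ᵥ c)) :
    (border P a d (P *ᵥ c)).PosSemidef := by
  have he : ∀ j, star ((Pi.single a 1 : ι → 𝕜) j) = (Pi.single a 1 : ι → 𝕜) j := fun j => by
    rw [← Pi.star_apply, Pi.star_single, star_one]
  have hH : (border P a d (P *ᵥ c)).IsHermitian := by
    refine Matrix.IsHermitian.ext fun i j => ?_
    rw [border_apply, border_apply, ← hP.1.apply i j]
    simp only [star_add, star_mul', star_star, he, hd.star_eq]
    ring
  refine .of_dotProduct_mulVec_nonneg hH fun x => ?_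
  have hu : star (P *ᵥ c) ⬝ᵥ x = star c ⬝ᵥ (P *ᵥ x) := by
    rw [Matrix.star_mulVec, ← dotProduct_mulVec, hP.1.eq]
  have key : star x ⬝ᵥ (border P a d (P *ᵥ c) *ᵥ x) =
      star (x + x a • c) ⬝ᵥ (P *ᵥ (x + x a • c)) +
        star (x a) * x a * (d - star c ⬝ᵥ (P *ᵥ c)) := by
    rw [quadForm_border, hu]
    simp only [star_add, star_smul, Matrix.mulVec_add, Matrix.mulVec_smul, add_dotProduct,
      dotProduct_add, smul_dotProduct, dotProduct_smul, smul_eq_mul]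
    ring
  rw [key]
  exact add_nonneg (hP.dotProduct_mulVec_nonneg _) (mul_nonneg (star_mul_self_nonneg (x a)) hdc)

end Border

/-! ### Positive semidefinite completion along a perfect elimination ordering -/

section Completion

variable [Fintype ι] [LinearOrder ι]

/-- RECURSIVE COMPLETION (the induction behind [VA15, Thm 10.1] in constructive form, cf.
[VA15, §10.2 (10.9)–(10.11)] and [GJSW84, Thm 7]): for a symmetric monotone-transitive pattern
`E` and any finite vertex set `S`, if for every `v ∈ S` some positive semidefinite matrix agrees
with `X` on `(col(v) ∩ S) × (col(v) ∩ S)`, then some positive semidefinite `Y` supported on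
`S × S` agrees with `X` on all prescribed entries inside `S × S`.  Induction on `S` eliminating
its lowest vertex `a`: complete on `S ∖ {a}` to `P`, then border `P` by `u = P c` with `c`
supported on `adj⁺(a) ∩ S` solving the range condition in the clique block of `a`.
[cite: VandenbergheAndersen2015, §10.1 Thm 10.1 (with §10.2 eq. (10.9)–(10.11))] -/
theorem exists_posSemidef_completion_of_subset {E : ι → ι → Prop}
    (hEs : ∀ ⦃i j : ι⦄, E i j → E j i) (hEm : MonotoneTransitive E) (X : Matrix ι ι 𝕜)
    (S : Finset ι) :
    (∀ v ∈ S, ∃ G : Matrix ι ι 𝕜, G.PosSemidef ∧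
        ∀ i ∈ S, i ∈ clique E v → ∀ j ∈ S, j ∈ clique E v → G i j = X i j) →
      ∃ Y : Matrix ι ι 𝕜, Y.PosSemidef ∧ (∀ i j, i ∉ S ∨ j ∉ S → Y i j = 0) ∧
        ∀ i ∈ S, ∀ j ∈ S, (i = j ∨ E i j) → Y i j = X i j := by
  induction S using Finset.induction_on_min with
  | empty =>
    intro _
    exact ⟨0, PosSemidef.zero, fun _ _ _ => rfl, fun i hi => absurd hi (Finset.notMem_empty i)⟩
  | insert a s hlt ih =>
    intro hloc
    -- complete on `s` by induction
    obtain ⟨P, hP, hP0, hPX⟩ := ih fun v hv => by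
      obtain ⟨G, hG, hGX⟩ := hloc v (Finset.mem_insert_of_mem hv)
      exact ⟨G, hG, fun i hi hiv j hj hjv =>
        hGX i (Finset.mem_insert_of_mem hi) hiv j (Finset.mem_insert_of_mem hj) hjv⟩
    -- the clique block of the lowest vertex `a`
    obtain ⟨G, hG, hGX⟩ := hloc a (Finset.mem_insert_self a s)
    have has : a ∉ s := fun h => lt_irrefl a (hlt a h)
    classical
    -- the higher neighbourhood of `a` inside `S`
    set N : Finset ι := s.filter (fun j => E a j) with hN
    have hNmem : ∀ {j}, j ∈ N ↔ j ∈ s ∧ E a j := by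
      intro j
      rw [hN, Finset.mem_filter]
    have hNclq : ∀ {j}, j ∈ N → j ∈ clique E a := fun hj =>
      mem_clique_iff.mpr (Or.inr ⟨hlt _ (hNmem.mp hj).1, (hNmem.mp hj).2⟩)
    have hNS : ∀ {j}, j ∈ N → j ∈ insert a s := fun hj =>
      Finset.mem_insert_of_mem (hNmem.mp hj).1
    have haS : a ∈ insert a s := Finset.mem_insert_self a s
    have haC : a ∈ clique E a := mem_clique_self E a
    -- `G` agrees with `X` on `({a} ∪ N) × ({a} ∪ N)`, `P` agrees with `X` on `N × N`
    have hGaa : G a a = X a a := hGX a haS haC a haS haC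
    have hGNa : ∀ {j}, j ∈ N → G j a = X j a := fun hj => hGX _ (hNS hj) (hNclq hj) a haS haC
    have hGaN : ∀ {j}, j ∈ N → G a j = X a j := fun hj => hGX a haS haC _ (hNS hj) (hNclq hj)
    have hGNN : ∀ {j k}, j ∈ N → k ∈ N → G j k = X j k := fun hj hk =>
      hGX _ (hNS hj) (hNclq hj) _ (hNS hk) (hNclq hk)
    have hPNN : ∀ {j k}, j ∈ N → k ∈ N → P j k = X j k := fun {j k} hj hk => by
      refine hPX j (hNmem.mp hj).1 k (hNmem.mp hk).1 ?_
      by_cases hjk : j = k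
      · exact Or.inl hjk
      · exact Or.inr (clique_complete hEs hEm a (hNclq hj) (hNclq hk) hjk)
    have hXaj : ∀ {j}, j ∈ N → star (X j a) = X a j := fun hj => by
      rw [← hGNa hj, hG.1.apply, hGaN hj]
    by_cases hd : X a a = 0
    · -- ZERO DIAGONAL ENTRY: the prescribed entries of row/column `a` vanish; take `Y = P`
      have hcol0 : ∀ {j}, j ∈ N → X j a = 0 ∧ X a j = 0 := fun {j} hj => by
        have h := apply_eq_zero_of_diag_eq_zero hG (hGaa.trans hd) j
        exact ⟨(hGNa hj).symm.trans h.1, (hGaN hj).symm.trans h.2⟩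
      refine ⟨P, hP, fun i j hij => hP0 i j ?_, fun i hi j hj hij => ?_⟩
      · exact hij.imp (fun h hi => h (Finset.mem_insert_of_mem hi))
          (fun h hj => h (Finset.mem_insert_of_mem hj))
      · rcases Finset.mem_insert.mp hi with hia | hi'
        · rw [hia] at hij ⊢
          rcases Finset.mem_insert.mp hj with hja | hj'
          · rw [hja, hP0 a a (Or.inl has), hd]
          · have hja : j ≠ a := fun h => has (h ▸ hj')
            have hE : E a j := hij.resolve_left fun h => hja h.symm
            rw [hP0 a j (Or.inl has), (hcol0 (hNmem.mpr ⟨hj', hE⟩)).2]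
        · have hia : i ≠ a := fun h => has (h ▸ hi')
          rcases Finset.mem_insert.mp hj with hja | hj'
          · rw [hja] at hij ⊢
            have hE : E a i := hEs (hij.resolve_left hia)
            rw [hP0 i a (Or.inr has), (hcol0 (hNmem.mpr ⟨hi', hE⟩)).1]
          · exact hPX i hi' j hj' hij
    · -- NONZERO DIAGONAL ENTRY: border `P` by `u = P c`, `c` from the range condition in `G`
      obtain ⟨c, hc0, hGc⟩ := exists_mulVec_eq_col_of_posSemidef hG N a
      have hPc_out : ∀ i, i ∉ s → (P *ᵥ c) i = 0 := fun i hi => by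
        simp only [Matrix.mulVec, dotProduct]
        exact Finset.sum_eq_zero fun k _ => by rw [hP0 i k (Or.inl hi), zero_mul]
      have hPcN : ∀ {j}, j ∈ N → (P *ᵥ c) j = X j a := fun {j} hj => by
        rw [← hGNa hj, ← hGc j hj, mulVec_apply_eq_sum_of_support hc0,
          mulVec_apply_eq_sum_of_support hc0]
        exact Finset.sum_congr rfl fun k hk => by rw [hPNN hj hk, hGNN hj hk]
      -- `γ = c⋆ P c = c⋆ G c = c⋆ G e_a = (e_a⋆ G c)⋆`
      have hγ : star c ⬝ᵥ (P *ᵥ c) = ∑ k ∈ N, star (c k) * G k a := by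
        rw [star_dotProduct_eq_sum_of_support hc0]
        exact Finset.sum_congr rfl fun k hk => by rw [hPcN hk, hGNa hk]
      have hγG : star c ⬝ᵥ (G *ᵥ c) = ∑ k ∈ N, star (c k) * G k a := by
        rw [star_dotProduct_eq_sum_of_support hc0]
        exact Finset.sum_congr rfl fun k hk => by rw [hGc k hk]
      have hcGa : star c ⬝ᵥ (G.col a) = ∑ k ∈ N, star (c k) * G k a := by
        rw [star_dotProduct_eq_sum_of_support hc0]
        rfl
      have hGca : star ((G *ᵥ c) a) = ∑ k ∈ N, star (c k) * G k a := by
        rw [mulVec_apply_eq_sum_of_support hc0, star_sum]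
        exact Finset.sum_congr rfl fun k _ => by rw [star_mul, hG.1.apply]
      -- `(e_a - c)⋆ G (e_a - c) = G_aa - (G c)_a ≥ 0`, hence `0 ≤ X_aa - c⋆ P c`
      have hq : star ((Pi.single a 1 : ι → 𝕜) - c) ⬝ᵥ (G *ᵥ ((Pi.single a 1 : ι → 𝕜) - c)) =
          G a a - (G *ᵥ c) a := by
        rw [star_sub, Pi.star_single, star_one, Matrix.mulVec_sub, Matrix.mulVec_single_one,
          sub_dotProduct, dotProduct_sub, dotProduct_sub, single_one_dotProduct,
          single_one_dotProduct, hcGa, hγG, sub_self, sub_zero]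
        rfl
      have hq0 : 0 ≤ G a a - (G *ᵥ c) a := by
        rw [← hq]
        exact hG.dotProduct_mulVec_nonneg _
      have hdc : 0 ≤ X a a - star c ⬝ᵥ (P *ᵥ c) := by
        have h1 : X a a - star c ⬝ᵥ (P *ᵥ c) = star (G a a - (G *ᵥ c) a) := by
          rw [star_sub, hG.1.apply a a, hGaa, hγ, hGca]
        rw [h1, (IsSelfAdjoint.of_nonneg hq0).star_eq]
        exact hq0
      have hdsa : IsSelfAdjoint (X a a) := by
        rw [← hGaa]
        exact hG.1.apply a a
      refine ⟨border P a (X a a) (P *ᵥ c), posSemidef_border hP a hdsa c hdc, fun i j hij => ?_,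
        fun i hi j hj hij => ?_⟩
      · -- support on `insert a s`
        rcases hij with hi | hj
        · have hia : i ≠ a := fun h => hi (h ▸ haS)
          have his : i ∉ s := fun h => hi (Finset.mem_insert_of_mem h)
          simp [border_apply, hP0 i j (Or.inl his), Pi.single_eq_of_ne hia, hPc_out i his]
        · have hja : j ≠ a := fun h => hj (h ▸ haS)
          have hjs : j ∉ s := fun h => hj (Finset.mem_insert_of_mem h)
          simp [border_apply, hP0 i j (Or.inr hjs), Pi.single_eq_of_ne hja, hPc_out j hjs]
      · -- the prescribed entries
        rcases Finset.mem_insert.mp hi with hia | hi'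
        · rw [hia] at hij ⊢
          rcases Finset.mem_insert.mp hj with hja | hj'
          · rw [hja]
            exact border_apply_same (X a a) (hP0 a a (Or.inl has)) (hPc_out a has)
          · have hja : j ≠ a := fun h => has (h ▸ hj')
            have hE : E a j := hij.resolve_left fun h => hja h.symm
            rw [border_apply_row (X a a) (P *ᵥ c) hja (hP0 a j (Or.inl has)),
              hPcN (hNmem.mpr ⟨hj', hE⟩), hXaj (hNmem.mpr ⟨hj', hE⟩)]
        · have hia : i ≠ a := fun h => has (h ▸ hi')
          rcases Finset.mem_insert.mp hj with hja | hj'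
          · rw [hja] at hij ⊢
            have hE : E a i := hEs (hij.resolve_left hia)
            rw [border_apply_col (X a a) (P *ᵥ c) hia (hP0 i a (Or.inr has)),
              hPcN (hNmem.mpr ⟨hi', hE⟩)]
          · rw [border_apply_of_ne P (X a a) (P *ᵥ c) hia (fun h => has (h ▸ hj'))]
            exact hPX i hi' j hj' hij

/-- **POSITIVE SEMIDEFINITE COMPLETION WITH A CHORDAL PATTERN** ([VA15, Thm 10.1]; Grone–Johnson–
Sá–Wolkowicz 1984, Thm 7), clique condition as local extendability: if the symmetric pattern `E`
is monotone transitive for the order of `ι` (a perfect elimination ordering) and for every vertex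
`v` some positive semidefinite matrix agrees with `X` on the clique block `col(v) × col(v)`, then
a single positive semidefinite `Y` agrees with `X` on every prescribed entry (`i = j` or
`{i,j} ∈ E`). [cite: VandenbergheAndersen2015, §10.1 Thm 10.1] -/
theorem exists_posSemidef_completion {E : ι → ι → Prop} (hEs : ∀ ⦃i j : ι⦄, E i j → E j i)
    (hEm : MonotoneTransitive E) {X : Matrix ι ι 𝕜}
    (hloc : ∀ v, ∃ G : Matrix ι ι 𝕜, G.PosSemidef ∧
      ∀ i ∈ clique E v, ∀ j ∈ clique E v, G i j = X i j) :
    ∃ Y : Matrix ι ι 𝕜, Y.PosSemidef ∧ ∀ i j, (i = j ∨ E i j) → Y i j = X i j := by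
  obtain ⟨Y, hY, -, hYX⟩ := exists_posSemidef_completion_of_subset hEs hEm X Finset.univ
    fun v _ => by
      obtain ⟨G, hG, hGX⟩ := hloc v
      exact ⟨G, hG, fun i _ hi j _ hj => hGX i hi j hj⟩
  exact ⟨Y, hY, fun i j hij => hYX i (Finset.mem_univ i) j (Finset.mem_univ j) hij⟩

/-- [VA15, Thm 10.1] as an equivalence, local-extendability form: a partial matrix with a
chordal (perfect-elimination-ordered) pattern has a positive semidefinite completion iff each
clique block `col(v) × col(v)` has one. [cite: VandenbergheAndersen2015, §10.1 Thm 10.1] -/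
theorem exists_posSemidef_completion_iff {E : ι → ι → Prop} (hEs : ∀ ⦃i j : ι⦄, E i j → E j i)
    (hEm : MonotoneTransitive E) (X : Matrix ι ι 𝕜) :
    (∃ Y : Matrix ι ι 𝕜, Y.PosSemidef ∧ ∀ i j, (i = j ∨ E i j) → Y i j = X i j) ↔
      ∀ v, ∃ G : Matrix ι ι 𝕜, G.PosSemidef ∧
        ∀ i ∈ clique E v, ∀ j ∈ clique E v, G i j = X i j := by
  refine ⟨fun ⟨Y, hY, hYX⟩ v => ⟨Y, hY, fun i hi j hj => hYX i j ?_⟩,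
    exists_posSemidef_completion hEs hEm⟩
  by_cases hij : i = j
  · exact Or.inl hij
  · exact Or.inr (clique_complete hEs hEm v hi hj hij)

/-- **[VA15, Thm 10.1] / [GJSW84, Thm 7] with the clique condition on principal submatrices**:
for a symmetric monotone-transitive (chordal, perfect-elimination-ordered) pattern `E`, a partial
matrix `X` has a positive semidefinite completion — `Y ⪰ 0` with `Y i j = X i j` whenever `i = j`
or `{i,j} ∈ E` — IF AND ONLY IF every clique block `X[col(v), col(v)]` is positive semidefinite
(`A ∈ Π_E(𝐒ⁿ₊) ⟺ A_ββ ⪰ 0` for all cliques `β`, (10.1)).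
[cite: VandenbergheAndersen2015, §10.1 Thm 10.1] -/
theorem posSemidef_completable_iff {E : ι → ι → Prop} (hEs : ∀ ⦃i j : ι⦄, E i j → E j i)
    (hEm : MonotoneTransitive E) (X : Matrix ι ι 𝕜) :
    (∃ Y : Matrix ι ι 𝕜, Y.PosSemidef ∧ ∀ i j, (i = j ∨ E i j) → Y i j = X i j) ↔
      ∀ v, (X.submatrix (Subtype.val : clique E v → ι) Subtype.val).PosSemidef := by
  constructor
  · rintro ⟨Y, hY, hYX⟩ v
    have hXY : X.submatrix (Subtype.val : clique E v → ι) (Subtype.val : clique E v → ι) =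
        Y.submatrix (Subtype.val : clique E v → ι) (Subtype.val : clique E v → ι) := by
      ext ⟨i, hi⟩ ⟨j, hj⟩
      simp only [submatrix_apply]
      refine (hYX i j ?_).symm
      by_cases hij : i = j
      · exact Or.inl hij
      · exact Or.inr (clique_complete hEs hEm v hi hj hij)
    rw [hXY]
    exact hY.submatrix _
  · intro hX
    classical
    refine exists_posSemidef_completion hEs hEm fun v => ?_
    -- pad the clique block back to `ι × ι` by a retraction `ι → col(v)` (PSD by `submatrix`)
    let f : ι → clique E v := fun i =>
      if h : i ∈ clique E v then ⟨i, h⟩ else ⟨v, mem_clique_self E v⟩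
    refine ⟨(X.submatrix (Subtype.val : clique E v → ι) Subtype.val).submatrix f f,
      (hX v).submatrix f, fun i hi j hj => ?_⟩
    simp [f, hi, hj]

/-- The completion theorem for a `SimpleGraph` whose vertex order is a perfect elimination
ordering (`MonotoneTransitive G.Adj`). [cite: VandenbergheAndersen2015, §10.1 Thm 10.1] -/
theorem simpleGraph_posSemidef_completable_iff (G : SimpleGraph ι) (hG : MonotoneTransitive G.Adj)
    (X : Matrix ι ι 𝕜) :
    (∃ Y : Matrix ι ι 𝕜, Y.PosSemidef ∧ ∀ i j, (i = j ∨ G.Adj i j) → Y i j = X i j) ↔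
      ∀ v, (X.submatrix (Subtype.val : clique G.Adj v → ι) Subtype.val).PosSemidef :=
  posSemidef_completable_iff (fun _ _ h => G.adj_symm h) hG X

end Completion

section Chordal

/-! ### Chordal versus non-chordal patterns: the order-free completion theorem and its converse
([VA15, Thm 10.1 and p. 357]; [GJSW84, Thm 7]) -/

open Literature.Combinatorics.SimpleGraph

variable [Fintype ι]

/-! #### Two matrix facts used by the counterexample -/

/-- A matrix with unit diagonal and off-diagonal entries `a i ⋆(a j)`, `|a i| ≤ 1`, is positive
semidefinite: it is `a a⋆ + Diag(1 - |a i|²)`. [folklore] -/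
private theorem posSemidef_of_unitDiag_rankOne [DecidableEq ι] (a : ι → 𝕜)
    (ha : ∀ i, a i * star (a i) ≤ 1) :
    (Matrix.of fun i j : ι => if i = j then (1 : 𝕜) else a i * star (a j)).PosSemidef := by
  have h : (Matrix.of fun i j : ι => if i = j then (1 : 𝕜) else a i * star (a j)) =
      vecMulVec a (star a) + diagonal fun i => 1 - a i * star (a i) := by
    ext i j
    by_cases hij : i = j
    · subst hij; simp [vecMulVec_apply]
    · simp [hij, vecMulVec_apply]
  rw [h]
  exact (posSemidef_vecMulVec_self_star a).add
    (posSemidef_diagonal_iff.2 fun i => sub_nonneg.2 (ha i))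

/-- In a positive semidefinite matrix, two indices `i, j` with `Y i i = Y j j = Y i j = Y j i = 1`
have equal columns (`(e_i - e_j)⋆ Y (e_i - e_j) = 0`, so `Y (e_i - e_j) = 0`). [folklore] -/
private theorem apply_eq_apply_of_posSemidef [DecidableEq ι] {Y : Matrix ι ι 𝕜} (hY : Y.PosSemidef)
    {i j : ι} (hii : Y i i = 1) (hjj : Y j j = 1) (hij : Y i j = 1) (hji : Y j i = 1) (l : ι) :
    Y l i = Y l j := by
  set x : ι → 𝕜 := Pi.single i 1 - Pi.single j 1 with hx
  have hYx : ∀ l, (Y *ᵥ x) l = Y l i - Y l j := by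
    intro l
    simp [hx, mulVec_sub]
  have h0 : star x ⬝ᵥ Y *ᵥ x = 0 := by
    have : star x = x := by
      ext l; simp [hx, Pi.single_apply, apply_ite star]
    rw [this, dotProduct]
    simp_rw [hYx]
    simp [hx, Pi.single_apply, Finset.sum_ite_eq', sub_mul, Finset.sum_sub_distrib, ite_mul,
      hii, hjj, hij, hji]
  have := (hY.dotProduct_mulVec_zero_iff x).1 h0
  have hl := congrFun this l
  rw [hYx, Pi.zero_apply, sub_eq_zero] at hl
  exact hl

/-- The value of the cyclic successor `finRotate n` on `Fin n`. [folklore] -/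
private theorem val_finRotate' {n : ℕ} (x : Fin n) :
    ((finRotate n x : Fin n) : ℕ) = if (x : ℕ) + 1 = n then 0 else (x : ℕ) + 1 := by
  obtain ⟨m, rfl⟩ : ∃ m, n = m + 1 := ⟨n - 1, (Nat.succ_pred_eq_of_pos x.pos).symm⟩
  rw [coe_finRotate]
  simp only [Fin.ext_iff, Fin.val_last]
  split_ifs <;> omega

/-- **Necessity of chordality for positive semidefinite completion** ([VA15, §10.1, p. 357];
[GJSW84, Thm 7 "only if" with Lemma 6]).  If the graph `G` has a chordless cycle
`(v₀, v₁, …, v_{k-1}, v₀)`, `k ≥ 4`, then the Hermitian matrix `X ∈ 𝐒ⁿ_E` with unit diagonal,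
`X_{vᵢ vᵢ₊₁} = 1` (`0 ≤ i ≤ k - 2`), `X_{v_{k-1} v₀} = -1` and all other entries zero has every
clique block `X[W, W]` (every principal submatrix on a complete vertex set `W`) positive
semidefinite — a clique meets the cycle in at most one edge — but NO positive semidefinite
completion: in a completion `Y ⪰ 0`, `Y_{vᵢvᵢ} = Y_{vᵢ₊₁vᵢ₊₁} = Y_{vᵢvᵢ₊₁} = 1` forces equal columns
`Y e_{vᵢ} = Y e_{vᵢ₊₁}`, so `-1 = Y_{v_{k-1} v₀} = Y_{v_{k-1} v_{k-2}} = 1`.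
[cite: VandenbergheAndersen2015, §10.1 (p. 357); GroneEtAl1984, §5 Thm 7 (p. 120, proof p. 121–122)]
-/
theorem exists_not_posSemidef_completable_of_isChordlessCycle {G : SimpleGraph ι} {k : ℕ}
    {c : Fin k → ι} (hc : IsChordlessCycle G c) :
    ∃ X : Matrix ι ι 𝕜, X.IsHermitian ∧ HasPattern G.Adj X ∧
      (∀ W : Finset ι, G.IsClique (W : Set ι) →
        (X.submatrix (Subtype.val : W → ι) Subtype.val).PosSemidef) ∧
      ¬ ∃ Y : Matrix ι ι 𝕜, Y.PosSemidef ∧ ∀ i j, (i = j ∨ G.Adj i j) → Y i j = X i j := by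
  classical
  have hk : 4 ≤ k := hc.four_le
  have hinj : ∀ {i j : Fin k}, c i = c j ↔ i = j := fun {i j} => hc.injective.eq_iff
  -- the no-chord condition and the cycle edges, on positions
  have hNC : ∀ ⦃i j : Fin k⦄, G.Adj (c i) (c j) →
      (j : ℕ) = i + 1 ∨ (i : ℕ) = j + 1 ∨ ((i : ℕ) = k - 1 ∧ (j : ℕ) = 0) ∨
        ((j : ℕ) = k - 1 ∧ (i : ℕ) = 0) := by
    intro i j h
    have hi := i.isLt
    have hj := j.isLt
    rcases hc.no_chord h with h1 | h1 <;> rw [Fin.ext_iff, val_finRotate'] at h1 <;>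
      split_ifs at h1 <;> omega
  have hadj : ∀ i j : Fin k, (j : ℕ) = i + 1 → G.Adj (c i) (c j) := by
    intro i j hij
    have h := hc.adj_next i
    have hv : finRotate k i = j :=
      Fin.ext (by rw [val_finRotate', hij]; have := j.isLt; split_ifs <;> omega)
    rwa [hv] at h
  have hadjL : G.Adj (c ⟨k - 1, by omega⟩) (c ⟨0, by omega⟩) := by
    have h := hc.adj_next ⟨k - 1, by omega⟩
    have hv : finRotate k ⟨k - 1, by omega⟩ = ⟨0, by omega⟩ :=
      Fin.ext (by rw [val_finRotate']; dsimp only; split_ifs <;> omega)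
    rwa [hv] at h
  -- the matrix: `t` = second-to-last vertex `v_{k-2}`, `c ⟨k-1, _⟩` = last vertex `v_{k-1}`
  set t : ι := c ⟨k - 2, by omega⟩ with ht_def
  let a : ι → 𝕜 := fun v => if v ∈ Set.range c then 1 else 0
  let b : ι → 𝕜 := fun v => if v = c ⟨k - 1, by omega⟩ then -1 else a v
  let X : Matrix ι ι 𝕜 := Matrix.of fun v w =>
    if v = w then 1 else if G.Adj v w then
      (if v = t ∨ w = t then a v * star (a w) else b v * star (b w)) else 0
  have ha_c : ∀ i, a (c i) = 1 := fun i => by simp [a]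
  have hb_c : ∀ i : Fin k, b (c i) = if (i : ℕ) = k - 1 then -1 else 1 := by
    intro i
    simp only [b, hinj, ha_c, Fin.ext_iff]
  have ha_star : ∀ v, star (a v) = a v := by
    intro v; simp only [a]; split_ifs <;> simp
  have hb_star : ∀ v, star (b v) = b v := by
    intro v; simp only [b]; split_ifs <;> simp [ha_star]
  have ha1 : ∀ v, a v * star (a v) ≤ 1 := by
    intro v; rw [ha_star]; simp only [a]; split_ifs <;> simp
  have hb1 : ∀ v, b v * star (b v) ≤ 1 := by
    intro v; rw [hb_star]; simp only [b, a]; split_ifs <;> simp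
  -- (1) `X` is Hermitian with pattern `E`
  have hXh : X.IsHermitian := by
    refine Matrix.IsHermitian.ext fun v w => ?_
    simp only [X, Matrix.of_apply]
    by_cases hvw : v = w
    · subst hvw; simp
    have hwv : ¬ w = v := fun h => hvw h.symm
    rw [if_neg hwv, if_neg hvw]
    by_cases hA : G.Adj v w
    · rw [if_pos hA.symm, if_pos hA]
      have hor : (w = t ∨ v = t) ↔ (v = t ∨ w = t) := Or.comm
      by_cases hvt : v = t ∨ w = t
      · rw [if_pos (hor.2 hvt), if_pos hvt, star_mul', star_star, mul_comm]
      · rw [if_neg (mt hor.1 hvt), if_neg hvt, star_mul', star_star, mul_comm]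
    · have hA' : ¬ G.Adj w v := fun h => hA h.symm
      rw [if_neg hA', if_neg hA, star_zero]
  have hXp : HasPattern G.Adj X := fun v w hvw hA => by
    simp only [X, Matrix.of_apply, if_neg hvw, if_neg hA]
  -- (2) every clique block of `X` is a block of one of two positive semidefinite matrices
  have hXW : ∀ W : Finset ι, G.IsClique (W : Set ι) →
      (X.submatrix (Subtype.val : W → ι) Subtype.val).PosSemidef := by
    intro W hW
    have hWadj : ∀ {v w : ι}, v ∈ W → w ∈ W → v ≠ w → G.Adj v w := fun hv hw hvw =>
      hW (Finset.mem_coe.2 hv) (Finset.mem_coe.2 hw) hvw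
    by_cases htW : t ∈ W
    · -- a neighbour `w ≠ v_{k-2}` of the last vertex inside `W` lies off the cycle
      -- (it is not `v₀`: that would make `{v₀, v_{k-2}} ⊆ W` a chord)
      have key : ∀ {w : ι}, w ∈ W → G.Adj (c ⟨k - 1, by omega⟩) w → w ≠ t →
          w ∉ Set.range c := by
        rintro w hw hA hwt ⟨j, rfl⟩
        have hj := j.isLt
        rcases hNC hA with h | h | h | h
        · dsimp only at h; omega
        · exact hwt (by rw [ht_def, hinj]; exact Fin.ext (by dsimp only at h ⊢; omega))
        · have hne : t ≠ c j := by
            rw [ht_def, Ne, hinj, Fin.ext_iff]; dsimp only; omega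
          rcases hNC (hWadj htW hw hne) with h' | h' | h' | h' <;>
            dsimp only at h' <;> omega
        · dsimp only at h; omega
      have hXP : X.submatrix (Subtype.val : W → ι) (Subtype.val : W → ι) =
          (Matrix.of fun i j : ι => if i = j then (1 : 𝕜) else a i * star (a j)).submatrix
            (Subtype.val : W → ι) (Subtype.val : W → ι) := by
        ext ⟨v, hv⟩ ⟨w, hw⟩
        simp only [submatrix_apply, X, Matrix.of_apply]
        by_cases hvw : v = w
        · simp [hvw]
        have hA := hWadj hv hw hvw
        rw [if_neg hvw, if_neg hvw, if_pos hA]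
        split_ifs with hvt
        · rfl
        · push Not at hvt
          by_cases hvL : v = c ⟨k - 1, by omega⟩
          · have hwc := key hw (hvL ▸ hA) hvt.2
            have haw : a w = 0 := by simp only [a, if_neg hwc]
            have hbw : b w = 0 := by
              simp only [b]
              rw [if_neg fun hwL => hwc ⟨_, hwL.symm⟩]
              exact haw
            simp [haw, hbw]
          by_cases hwL : w = c ⟨k - 1, by omega⟩
          · have hvc := key hv (hwL ▸ hA.symm) hvt.1
            have hav : a v = 0 := by simp only [a, if_neg hvc]
            have hbv : b v = 0 := by
              simp only [b]
              rw [if_neg fun hvL' => hvc ⟨_, hvL'.symm⟩]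
              exact hav
            simp [hav, hbv]
          · simp only [b, if_neg hvL, if_neg hwL]
      rw [hXP]
      exact (posSemidef_of_unitDiag_rankOne a ha1).submatrix _
    · have hXP : X.submatrix (Subtype.val : W → ι) (Subtype.val : W → ι) =
          (Matrix.of fun i j : ι => if i = j then (1 : 𝕜) else b i * star (b j)).submatrix
            (Subtype.val : W → ι) (Subtype.val : W → ι) := by
        ext ⟨v, hv⟩ ⟨w, hw⟩
        simp only [submatrix_apply, X, Matrix.of_apply]
        by_cases hvw : v = w
        · simp [hvw]
        have hvt : ¬ (v = t ∨ w = t) := by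
          rintro (rfl | rfl)
          · exact htW hv
          · exact htW hw
        rw [if_neg hvw, if_neg hvw, if_pos (hWadj hv hw hvw), if_neg hvt]
      rw [hXP]
      exact (posSemidef_of_unitDiag_rankOne b hb1).submatrix _
  -- (3) the entries of `X` along the path `v₀, …, v_{k-1}` are `1`
  have hX1 : ∀ {i j : Fin k}, G.Adj (c i) (c j) → ¬ ((i : ℕ) = k - 1 ∧ (j : ℕ) = 0) →
      ¬ ((j : ℕ) = k - 1 ∧ (i : ℕ) = 0) → X (c i) (c j) = 1 := by
    intro i j hA h1 h2
    have hne : c i ≠ c j := G.ne_of_adj hA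
    simp only [X, Matrix.of_apply, if_neg hne, if_pos hA]
    split_ifs with hvt
    · simp [ha_c]
    · have hi := i.isLt
      have hj := j.isLt
      have hiL : (i : ℕ) ≠ k - 1 := by
        intro hiv
        rcases hNC hA with h | h | h | h
        · omega
        · exact hvt (Or.inr (by rw [ht_def, hinj]; exact Fin.ext (by dsimp only; omega)))
        · exact h1 h
        · omega
      have hjL : (j : ℕ) ≠ k - 1 := by
        intro hjv
        rcases hNC hA with h | h | h | h
        · exact hvt (Or.inl (by rw [ht_def, hinj]; exact Fin.ext (by dsimp only; omega)))
        · omega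
        · omega
        · exact h2 h
      rw [hb_c, hb_c, if_neg hiL, if_neg hjL]
      simp
  -- (4) no positive semidefinite completion
  refine ⟨X, hXh, hXp, hXW, ?_⟩
  rintro ⟨Y, hY, hYX⟩
  have hYd : ∀ i, Y (c i) (c i) = 1 := fun i => by
    rw [hYX _ _ (Or.inl rfl)]
    simp [X]
  -- the columns of `v₀, v₁, …, v_{k-2}` in `Y` coincide
  have hcol : ∀ n (hn : n ≤ k - 2) (l : ι), Y l (c ⟨0, by omega⟩) = Y l (c ⟨n, by omega⟩) := by
    intro n
    induction n with
    | zero => intro _ l; rfl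
    | succ n ih =>
      intro hn l
      rw [ih (by omega) l]
      have hA : G.Adj (c ⟨n, by omega⟩) (c ⟨n + 1, by omega⟩) := hadj _ _ rfl
      refine apply_eq_apply_of_posSemidef hY (hYd _) (hYd _) ?_ ?_ l
      · rw [hYX _ _ (Or.inr hA)]
        exact hX1 hA (by dsimp only; omega) (by dsimp only; omega)
      · rw [hYX _ _ (Or.inr hA.symm)]
        exact hX1 hA.symm (by dsimp only; omega) (by dsimp only; omega)
  have h1 : Y (c ⟨k - 1, by omega⟩) (c ⟨k - 2, by omega⟩) = 1 := by
    have hA : G.Adj (c ⟨k - 2, by omega⟩) (c ⟨k - 1, by omega⟩) :=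
      hadj _ _ (by dsimp only; omega)
    rw [hYX _ _ (Or.inr hA.symm)]
    exact hX1 hA.symm (by dsimp only; omega) (by dsimp only; omega)
  have h2 : Y (c ⟨k - 1, by omega⟩) (c ⟨0, by omega⟩) = -1 := by
    rw [hYX _ _ (Or.inr hadjL)]
    have hne : c ⟨k - 1, by omega⟩ ≠ c ⟨0, by omega⟩ := by
      rw [Ne, hinj, Fin.ext_iff]; dsimp only; omega
    have hLt : ¬ (c ⟨k - 1, by omega⟩ = t ∨ c ⟨0, by omega⟩ = t) := by
      rw [ht_def, hinj, hinj, Fin.ext_iff, Fin.ext_iff]; dsimp only; omega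
    simp only [X, Matrix.of_apply, if_neg hne, if_pos hadjL, if_neg hLt, hb_c, if_true]
    rw [if_neg (by omega)]
    simp
  have h := hcol (k - 2) le_rfl (c ⟨k - 1, by omega⟩)
  rw [h1, h2] at h
  have h' := congrArg RCLike.re h
  norm_num at h'

/-- The counterexample for a non-chordal graph: some Hermitian `X ∈ 𝐒ⁿ_E` with all clique
blocks positive semidefinite has no positive semidefinite completion.
[cite: VandenbergheAndersen2015, §10.1 (p. 357); GroneEtAl1984, §5 Thm 7 (p. 120)] -/
theorem exists_not_posSemidef_completable_of_not_isChordal {G : SimpleGraph ι}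
    (hG : ¬ IsChordal G) :
    ∃ X : Matrix ι ι 𝕜, X.IsHermitian ∧ HasPattern G.Adj X ∧
      (∀ W : Finset ι, G.IsClique (W : Set ι) →
        (X.submatrix (Subtype.val : W → ι) Subtype.val).PosSemidef) ∧
      ¬ ∃ Y : Matrix ι ι 𝕜, Y.PosSemidef ∧ ∀ i j, (i = j ∨ G.Adj i j) → Y i j = X i j := by
  simp only [IsChordal, not_forall, not_not] at hG
  obtain ⟨k, c, hc⟩ := hG
  exact exists_not_posSemidef_completable_of_isChordlessCycle hc

/-- **[VA15, Thm 10.1] for a chordal graph, order-free form**: if the sparsity graph `G` is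
chordal (no chordless cycle of length `≥ 4`), a partial matrix `X` all of whose CLIQUE BLOCKS
`X[W, W]` (`W` complete in `G`) are positive semidefinite has a positive semidefinite completion.
By [VA15, Thm 4.1] (`ChordalGraph`: Dirac) `G` has a perfect elimination ordering, along which
`posSemidef_completable_iff` completes; its cliques `col(v)` are complete sets.
[cite: VandenbergheAndersen2015, §10.1 Thm 10.1 (with §4.2 Thm 4.1)] -/
theorem _root_.Literature.Combinatorics.SimpleGraph.IsChordal.exists_posSemidef_completion
    {G : SimpleGraph ι} (hG : IsChordal G) {X : Matrix ι ι 𝕜}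
    (hX : ∀ W : Finset ι, G.IsClique (W : Set ι) →
      (X.submatrix (Subtype.val : W → ι) Subtype.val).PosSemidef) :
    ∃ Y : Matrix ι ι 𝕜, Y.PosSemidef ∧ ∀ i j, (i = j ∨ G.Adj i j) → Y i j = X i j := by
  classical
  have : Finite ι := inferInstance
  obtain ⟨o, ho⟩ := isChordal_iff_exists_linearOrder_monotoneTransitive'.1 hG
  letI : LinearOrder ι := o
  have hEs : ∀ ⦃i j : ι⦄, G.Adj i j → G.Adj j i := fun _ _ h => h.symm
  refine (posSemidef_completable_iff (𝕜 := 𝕜) hEs ho X).2 fun v => ?_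
  set W : Finset ι := (clique G.Adj v).toFinset with hW_def
  have hW : G.IsClique (W : Set ι) := by
    intro i hi j hj hij
    rw [hW_def, Set.coe_toFinset] at hi hj
    exact clique_complete hEs ho v hi hj hij
  let f : clique G.Adj v → W := fun x => ⟨x.1, by rw [hW_def, Set.mem_toFinset]; exact x.2⟩
  have h := (hX W hW).submatrix f
  rwa [Matrix.submatrix_submatrix] at h

/-- **[GJSW84, Thm 7] = [VA15, Thm 10.1 with the remark on p. 357]: the positive semidefinite
completable patterns are exactly the chordal ones.**  A finite graph `G` is chordal if and only if
EVERY partial matrix with pattern `G` whose clique blocks `X[W, W]` (`W` complete) are all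
positive semidefinite — a "`G`-partial nonnegative matrix" — has a positive semidefinite
completion `Y ⪰ 0`, `Y i j = X i j` for `i = j` or `{i,j} ∈ E` (`G` is "(nonnegative-)completable";
[GJSW84, Prop. 1–2] identify the positive definite and semidefinite versions).
[cite: GroneEtAl1984, §5 Thm 7 (p. 120); VandenbergheAndersen2015, §10.1 Thm 10.1 and p. 357] -/
theorem _root_.Literature.Combinatorics.SimpleGraph.isChordal_iff_forall_posSemidef_completable
    (G : SimpleGraph ι) :
    IsChordal G ↔ ∀ X : Matrix ι ι 𝕜,
      (∀ W : Finset ι, G.IsClique (W : Set ι) →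
        (X.submatrix (Subtype.val : W → ι) Subtype.val).PosSemidef) →
      ∃ Y : Matrix ι ι 𝕜, Y.PosSemidef ∧ ∀ i j, (i = j ∨ G.Adj i j) → Y i j = X i j := by
  refine ⟨fun hG X hX => hG.exists_posSemidef_completion hX, fun h => ?_⟩
  by_contra hG
  obtain ⟨X, -, -, hXW, hno⟩ := exists_not_posSemidef_completable_of_not_isChordal (𝕜 := 𝕜) hG
  exact hno (h X hXW)

end Chordal

end ChordalSparsity

end Literature.LinearAlgebra.Matrix

end
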